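import Literature.Probability.RandomPlanarGeometry.WholePlaneSLEKappaRhoExistenceEight
import Literature.Probability.RandomPlanarGeometry.CritPercSLESpaceFillingDecomposition
import Literature.Probability.RandomPlanarGeometry.LSW2004USTThm44
import HarnessLib

/-!
# Whole-plane SLE_κ(ρ) exists given the two uniform-spanning-tree inputs of [LSW04] Thm. 4.7

Topic `Probability/RandomPlanarGeometry`; theorems only (no definition, no named fact).

The named fact `IsWholePlaneSLEKappaRho.exists` (J. Miller, S. Sheffield, *Imaginary geometry
IV*, Prop. 2.5 with Prop. 2.1: for `0 < κ ≤ 2(ρ + 2)` there is a whole-plane SLE_κ(ρ) generated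
by a continuous curve) is a theorem of the tree at every `κ ≠ 8`
(`IsWholePlaneSLEKappaRho.exists_ne_eight`, over Rohde–Schramm) and is reduced at `κ = 8` to the
canonical chordal trace theorem `hasSLETrace_eight` (G. F. Lawler, O. Schramm, W. Werner (2004)
[LSW04], Thm. 4.7: chordal SLE₈ is generated by a continuous curve) by
`IsWholePlaneSLEKappaRho.exists_of_hasSLETrace_eight` (`WholePlaneSLEKappaRhoExistenceEight.lean`:
transport of the canonical statement to every Brownian motion, then the whole-plane pipeline
`exists_of_chordal_eight`). In turn `hasSLETrace_eight` is a theorem of the tree GIVEN the two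
uniform-spanning-tree statements of [LSW04] §4 (`USTPeano.hasSLETrace_eight_holds_of`,
`CritPercSLESpaceFillingDecomposition.lean`, with `USTPeano.drivingProcess_tendsto_holds_of`,
`LSW2004USTThm44.lean`: Prop. 4.5 from Lemma 4.6, tightness, Prokhorov, the identification of the
limit through the convergence of the driving processes):

* `USTPeano.LawlerSchrammWerner2004_lemma46` — [LSW04] Lemma 4.6 (p. 978), the regularity
  estimate for the UST Peano curve in the capacity parametrisation (printed proof: Wilson's
  algorithm and the loop-erased random walk estimates of Schramm (2000));
* `USTPeano.thm44_coupling` — [LSW04] Thm. 4.4 (p. 976), the Loewner driving process of the UST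
  Peano curve of one lattice domain `D ∈ 𝔇*` is close to `B(8t)` (printed proof: the Markovian
  property of the Peano curve, Wilson's algorithm, the Dirichlet–Neumann approximation of §4.1
  proved in §5.4, the key estimate of §4.2 and the Skorokhod embedding of §3.3 — of which the tree
  has the Loewner-side computation `LSW2004KeyEstimateComputation.lean` and the embedding engine
  `DrivingConvergenceEngine.lean`, not the discrete potential theory).

This file records the composite reduction as one theorem, so that the discharge of the
whole-plane fact is the term
`IsWholePlaneSLEKappaRho.exists_of_ust_inputs lemma46_holds thm44_coupling_holds` as soon as the
two leaves are theorems (and nothing else is missing: every other input of Miller–Sheffield's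
proof — the stationary SDE (2.1), Prop. 2.1, the whole-plane Loewner chain, the radial
continuity Prop. 2.3 with Lemma 2.4 for `κ ≠ 8`, and the transport at `κ = 8` — is proved in the
tree):

* `IsWholePlaneSLEKappaRho.exists_of_ust_inputs` —
  `USTPeano.LawlerSchrammWerner2004_lemma46 → USTPeano.thm44_coupling →
  IsWholePlaneSLEKappaRho.exists`.

## References

* J. Miller, S. Sheffield, *Imaginary geometry IV: interior rays, whole-plane reversibility, and
  space-filling trees*, Probab. Theory Related Fields 169 (2017), arXiv:1302.4738: Prop. 2.1,
  Prop. 2.3, Lemma 2.4, Prop. 2.5. [MillerSheffield2013]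
* G. F. Lawler, O. Schramm, W. Werner, *Conformal invariance of planar loop-erased random walks
  and uniform spanning trees*, Ann. Probab. 32 (2004), 939–995: Thm. 4.4 (p. 976), Prop. 4.5
  (p. 977), Lemma 4.6 (p. 978), Thm. 4.7 (p. 981). [LawlerSchrammWerner2004]
* S. Rohde, O. Schramm, *Basic properties of SLE*, Ann. of Math. 161 (2005), Thm. 5.1.
  [RohdeSchramm2005]
-/

noncomputable section

namespace Literature.Probability.RandomPlanarGeometry

/-- **Whole-plane SLE_κ(ρ) exists for all `0 < κ ≤ 2(ρ + 2)` (Miller–Sheffield, Prop. 2.5 with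
Prop. 2.1), given the two uniform-spanning-tree inputs of [LSW04] Thm. 4.7** — Lemma 4.6
(`USTPeano.LawlerSchrammWerner2004_lemma46`) and Thm. 4.4 (`USTPeano.thm44_coupling`): they give
`hasSLETrace_eight` (`USTPeano.hasSLETrace_eight_holds_of`,
`USTPeano.drivingProcess_tendsto_holds_of`), whence the fact by
`IsWholePlaneSLEKappaRho.exists_of_hasSLETrace_eight` (every `κ ≠ 8` being unconditional,
`IsWholePlaneSLEKappaRho.exists_ne_eight`). [cite: MillerSheffield2013, Prop. 2.5] -/
theorem IsWholePlaneSLEKappaRho.exists_of_ust_inputs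
    (h46 : USTPeano.LawlerSchrammWerner2004_lemma46) (h44 : USTPeano.thm44_coupling) :
    IsWholePlaneSLEKappaRho.exists :=
  IsWholePlaneSLEKappaRho.exists_of_hasSLETrace_eight
    (USTPeano.hasSLETrace_eight_holds_of h46 (USTPeano.drivingProcess_tendsto_holds_of h44))

end Literature.Probability.RandomPlanarGeometry

end
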